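import Summits.RiemannHypothesis.RiemannHypothesis.Theorems.PfPersistenceDilatingLandau
import Literature.NumberTheory.LFunctions.SchoenfeldExplicitThm10Proofs
import HarnessLib

/-!
# `PfPersistenceDilatingLandauExplicit` — the explicit one-sided RH-equivalence, named fact plugged in

pub-rhpf cell (mechanism/rigidity campaign; no RH claims), seat `pub-rhpf-cand-7` gen 8, companion of
`PfPersistenceDilatingLandau.lean` (LANDAU kernel target). That file proves
`riemannHypothesis_iff_psi_le_schoenfeld (h10 : Schoenfeld1976_thm10) : RH ↔ ∀ᶠ x, ψ(x) − x ≤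
√x (log x − 2) log x / (8π)` with Schoenfeld's Theorem 10 as the tree's NAMED FACT; the tree DISCHARGES
that fact (`Literature.NumberTheory.LFunctions.Schoenfeld1976_thm10_holds`,
`SchoenfeldExplicitThm10Proofs.lean`, whose axiom closure contains `native_decide` certificates of the
low zero sums). This file only plugs the discharge in, so the UNCONDITIONAL explicit equivalences are
on record by name while the computational axioms stay confined to this companion.

References: L. Schoenfeld, Math. Comp. 30 (1976) Thm 10 (6.1); Montgomery–Vaughan (2007) Thm 15.3.
-/

noncomputable section

-- the sub-problem path RiemannHypothesis/RiemannHypothesis duplicates a namespace (D-0017)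
set_option linter.dupNamespace false

open Filter Real
open scoped Chebyshev

namespace Summit.RiemannHypothesis.RiemannHypothesis.Theorems.PfPersistenceDilatingLandauExplicit

open Literature.NumberTheory.LFunctions
open Summit.RiemannHypothesis.RiemannHypothesis.Theorems.PfPersistenceDilatingLandau

/-- **RH ⟺ `ψ(x) − x ≤ √x (log x − 2) log x / (8π)` eventually** — unconditional equivalence
(Schoenfeld's Theorem 10 discharged in tree). COMPUTATIONAL axiom closure (native_decide, inherited
from `Schoenfeld1976_thm10_holds`). [cite: Schoenfeld1976, Thm. 10 (6.1)] -/
theorem riemannHypothesis_iff_psi_le_schoenfeld_holds :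
    RiemannHypothesis ↔
      ∀ᶠ x in atTop, ψ x - x ≤ √x * (Real.log x - 2) * Real.log x / (8 * π) :=
  riemannHypothesis_iff_psi_le_schoenfeld Schoenfeld1976_thm10_holds

/-- **RH ⟺ `−√x (log x − 2) log x / (8π) ≤ ψ(x) − x` eventually** — unconditional (computational
axiom closure as above). [cite: Schoenfeld1976, Thm. 10 (6.1)] -/
theorem riemannHypothesis_iff_schoenfeld_le_psi_holds :
    RiemannHypothesis ↔
      ∀ᶠ x in atTop, -(√x * (Real.log x - 2) * Real.log x / (8 * π)) ≤ ψ x - x :=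
  riemannHypothesis_iff_schoenfeld_le_psi Schoenfeld1976_thm10_holds

/-- Under RH the explicit one-sided bounds hold for every `x ≥ 23·10⁸` (not just eventually):
the `→` direction with Schoenfeld's threshold. [cite: Schoenfeld1976, Thm. 10 (6.1)] -/
theorem psi_sub_le_schoenfeld_of_riemannHypothesis (hRH : RiemannHypothesis) {x : ℝ}
    (hx : 23 * 10 ^ 8 ≤ x) :
    -(√x * (Real.log x - 2) * Real.log x / (8 * π)) ≤ ψ x - x ∧
      ψ x - x ≤ √x * (Real.log x - 2) * Real.log x / (8 * π) :=
  abs_le.1 (Schoenfeld1976_thm10_holds hRH x hx).1.le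

end Summit.RiemannHypothesis.RiemannHypothesis.Theorems.PfPersistenceDilatingLandauExplicit
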